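/-
Origin: expansion seat `planner-pub-hodgecm-landherr-g2-0`, handover 2026-08-18T03:35:56Z (`HOME/pub-hodgecm-landherr-g2/SeesawConstruction.lean`, md5 eed5289f, 547 lines);
landed by the gen-5 packager in gate run 19 as `HodgeCM/Proofs/SeesawConstruction.lean` (verbatim).
-/
/-
Copyright: pub-hodgecm formalisation cell (harness21, 2026). New file (not vendored).
Origin: HOME/pub-hodgecm-landherr-g2/SeesawConstruction.lean — session planner-pub-hodgecm-landherr-g2-0 (unit
pub-hodgecm-landherr-g2, expansion part (c), gen 2).  Intended final place: `HodgeCM/Proofs/SeesawConstruction.lean`.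
Names follow the run-18 vocabulary of `HodgeCM.Automorphic.ThetaFacts` (`ThetaModel.Inputs`, `Design_kappaConj`,
`Design_frameSignConj`); nothing is asserted (every input is an explicit hypothesis; fully proved, no new constants).
-/
import Summits.HodgeConjecture.HodgeCM.Proofs.LandherrClassification
import Summits.HodgeConjecture.HodgeCM.Assembly.CorCMThetaPrime

set_option autoImplicit false

/-!
# Def 3.2's seesaw plane WITHOUT Landherr / Hasse–Minkowski

PerL v5 §3.2 (tex ll. 299–304, `HOME/inputs/2001/…pmqp-galois-closure-y1__paper-v5-d912a121.tex`):
"By Lemma 3.3(b) and Landherr's theorem (hermitian spaces over `L/L₀` are classified by dimension,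
determinant in `L₀^×/N(L^×)` and signatures) we may and do choose the lines so that `W₁ ⊕ W₂ ≅ W₃ ⊕ W₄`."
The lines `W_i = (L, a_i x ȳ)` are at our disposal subject only to the FORCED SIGNS of Lemma 3.3(a)
(`ThetaModel.reqPos`, `ThetaModel.SignsForced`).  Since run 16 the package obtains the isometry from the
classification target `HodgeCM.Lemma33bLandherr` (`ThetaModel.exists_seesawDatum (hL : Lemma33bLandherr)`,
`HodgeCM/Proofs/RealisationConstruction.lean`), itself reduced to the cited Hasse–Minkowski input
`HodgeCM.HasseMinkowskiQuinary` (run 14).  Here we CONSTRUCT the four lines so that the isometry holds BY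
CONSTRUCTION, with no local–global principle:

* `a₀ := e₀ · t`, `a₁ := e₁`, `a₂ := a₀ + a₁`, `a₃ := a₀ a₁ a₂⁻¹`, where `e₀, e₁ ∈ L⁺` have the required signs
  (`HodgeCM.exists_isReal_signs`, weak approximation of signs) and `t ∈ L⁺` is TOTALLY POSITIVE with prescribed
  MAGNITUDES at the real places (`HodgeCM.exists_totallyPositive_magnitudes`, this file: at the places where
  `a₀, a₁` must have opposite signs, `t > |e₁/e₀|` if `a₂` must follow the sign of `a₀` and `t < |e₁/e₀|` if it
  must follow the sign of `a₁`; proved from Dirichlet's unit theorem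
  `NumberField.Units.dirichletUnitTheorem.exists_unit` — the input already used by
  `HodgeCM.exists_neg_at_pos_off` — and `x^n → ∞` (`x > 1`), `x^n → 0` (`0 ≤ x < 1`));
* then `⟨a₀, a₁⟩` represents `a₂ = a₀ N(1) + a₁ N(1)` and `a₀a₁ = a₂a₃ N(1)`, so the explicit matrix of
  `HodgeCM.Lemma33bLandherrProof.isometry_of_rep` (run 14, pure algebra) is an isometry `W₁ ⊕ W₂ ≅ W₃ ⊕ W₄`;
  the sign of `a₃` is the parity consequence of the pair-sum identity (`ThetaModel.reqPos_pairSum`), as in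
  `ThetaModel.exists_signsForced`.

Consequences (all PROVED here, no new hypothesis): `ThetaModel.exists_seesawDatum_constructed`
(= `exists_seesawDatum` without `hL`), `ThetaModel.nonempty_thetaRealisation_of_seesaw` (the construction of
`RealisationConstruction.lean` run from ANY forced-sign seesaw datum; proof body = prl1's, verbatim) and — with
`HodgeCM.levelDirected` (`HodgeCM/Proofs/LevelDirected.lean`) also plugged in — the versions free of BOTH
`LevelDirected` and `Lemma33bLandherr`: `nonempty_thetaRealisation''`, `realisationExistsPerL_of''`,
`realisationExistsFace_of''`, `realisationExists_of''`, `Assembly.perL_theta''`, `Assembly.periodThmF_theta''`,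
`Assembly.COR_CM_theta''`, the record `Assembly.OpenInputsTheta''` (= `OpenInputsTheta'` minus the field
`landherr`: fields `theta`, `hodgeRiemann20`, `pohlmann_span`, `qw8_sufficiency`) with
`Assembly.openInputsTheta''_of`, `Assembly.openInputs_of_theta''`, `Assembly.COR_CM_of_openInputsTheta''`.
So neither Landherr's theorem nor the Hasse–Minkowski theorem is used anywhere in the cone of the theta-model
headline theorems: `perL_theta'' (M) (T) (A : T.Inputs) (hHR : U.Fact_hodgeRiemann20) : U.PerL` and
`COR_CM_theta'' (M) (T) (A) (hHR) (hP : U.PohlmannSpan) (hQ : U.Qw8Sufficiency) : U.HC_CM`.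
`HodgeCM.Lemma33bLandherr` keeps its status of a typed side target (reduced to `HasseMinkowskiQuinary` in run 14,
converse proved in run 15, PROVED OUTRIGHT in run 22: `HodgeCM.lemma33bLandherr_holds`), OUTSIDE every headline cone.
-/

noncomputable section

open scoped TensorProduct InnerProductSpace Matrix
open Filter Topology
open NumberField NumberField.InfinitePlace

namespace HodgeCM

open Literature.AlgebraicGeometry.Motives (CMType HodgeStructure)
open Literature.AlgebraicGeometry.Motives.HodgeStructure (conj)
open Literature.AlgebraicGeometry.ShimuraVarieties (conjRingHomK embedding_conjRingHomK)
open HodgeCM.Prior.Perl34File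
open CMTypeOps

/-! ### Weak approximation with magnitudes at the real places of `L₀ ⊂ L` -/

/-- At the place `v` singled out by Dirichlet's unit theorem the unit has absolute value `> 1`, provided there is
another infinite place (product formula `∑_w mult(w) · log |u|_w = 0`). -/
theorem one_lt_of_dirichletUnit (L : CMField) (v : InfinitePlace L) (u : (𝓞 L)ˣ)
    (hu : ∀ w : InfinitePlace L, w ≠ v → Real.log (w ((u : 𝓞 L) : L)) < 0)
    (hne : ∃ w : InfinitePlace L, w ≠ v) : 1 < v ((u : 𝓞 L) : L) := by
  classical
  obtain ⟨w₀, hw₀⟩ := hne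
  have h := Units.sum_mult_mul_log u
  rw [Fintype.sum_eq_add_sum_subtype_ne _ v] at h
  have hN : Nonempty {w : InfinitePlace L // w ≠ v} := ⟨⟨w₀, hw₀⟩⟩
  have hneg : ∑ w : {w : InfinitePlace L // w ≠ v},
      ((w : InfinitePlace L).mult : ℝ) * Real.log ((w : InfinitePlace L) ((u : 𝓞 L) : L)) < 0 := by
    calc ∑ w : {w : InfinitePlace L // w ≠ v},
          ((w : InfinitePlace L).mult : ℝ) * Real.log ((w : InfinitePlace L) ((u : 𝓞 L) : L))
        < ∑ _w : {w : InfinitePlace L // w ≠ v}, (0 : ℝ) := by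
          apply Finset.sum_lt_sum_of_nonempty Finset.univ_nonempty
          intro w _
          exact mul_neg_of_pos_of_neg (Nat.cast_pos.mpr mult_pos) (hu w.1 w.2)
      _ = 0 := by simp
  have hpos : 0 < (v.mult : ℝ) * Real.log (v ((u : 𝓞 L) : L)) := by linarith
  have hlog : 0 < Real.log (v ((u : 𝓞 L) : L)) := by
    rcases mul_pos_iff.mp hpos with ⟨_, h2⟩ | ⟨h1, _⟩
    · exact h2
    · exact absurd h1 (not_lt.mpr (Nat.cast_nonneg _))
  exact (Real.log_pos_iff (Units.pos_at_place u v).le).mp hlog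

/-- **Totally positive elements of `L⁺` with prescribed magnitudes.**  For every finite set `B` of infinite
places of the CM field `L` and every positive threshold function `C` there is `t ∈ L`, fixed by complex
conjugation, with `τ t` a POSITIVE real at every complex embedding `τ`, `τ t > C(place of τ)` at the places in `B`
and `τ t < C(place of τ)` at the places outside `B`.  Proof: induction on `B`; the empty case is a small rational
number; the step `B ↦ B ∪ {v}` adds `x^n` with `x = u ū`, `u` the unit of Dirichlet's theorem
(`dirichletUnitTheorem.exists_unit L v`: `|u|_w < 1` for `w ≠ v`, hence `|u|_v > 1`), and `n` large
(`x^n → ∞` at `v`, `x^n → 0` elsewhere); if `v` is the only infinite place, a large natural number does it. -/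
theorem exists_totallyPositive_magnitudes (L : CMField) (B : Finset (InfinitePlace L))
    (C : InfinitePlace L → ℝ) (hC : ∀ w, 0 < C w) :
    ∃ t : L, conjRingHomK L t = t ∧
      ∀ τ : L →+* ℂ, τ t = ((τ t).re : ℂ) ∧ 0 < (τ t).re ∧
        (InfinitePlace.mk τ ∈ B → C (InfinitePlace.mk τ) < (τ t).re) ∧
        (InfinitePlace.mk τ ∉ B → (τ t).re < C (InfinitePlace.mk τ)) := by
  classical
  induction B using Finset.induction_on with
  | empty =>
    -- a rational number `1/N` below every threshold
    obtain ⟨N, hN⟩ := exists_nat_gt (∑ w : InfinitePlace L, (C w)⁻¹)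
    have hNpos : (0 : ℝ) < N :=
      lt_of_le_of_lt (Finset.sum_nonneg fun w _ => (inv_pos.mpr (hC w)).le) hN
    refine ⟨(N : L)⁻¹, by rw [map_inv₀, map_natCast], fun τ => ?_⟩
    have hτ : τ ((N : L)⁻¹) = (((N : ℝ)⁻¹ : ℝ) : ℂ) := by
      rw [map_inv₀, map_natCast, Complex.ofReal_inv, Complex.ofReal_natCast]
    rw [hτ, Complex.ofReal_re]
    refine ⟨rfl, inv_pos.mpr hNpos, fun h => absurd h (Finset.notMem_empty _), fun _ => ?_⟩
    have hle : (C (InfinitePlace.mk τ))⁻¹ ≤ ∑ w : InfinitePlace L, (C w)⁻¹ :=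
      Finset.single_le_sum (f := fun w => (C w)⁻¹) (fun w _ => (inv_pos.mpr (hC w)).le)
        (Finset.mem_univ (InfinitePlace.mk τ))
    exact (inv_lt_comm₀ hNpos (hC _)).mpr (lt_of_le_of_lt hle hN)
  | @insert v B hv ih =>
    obtain ⟨t, ht, hT⟩ := ih
    by_cases hone : ∀ τ : L →+* ℂ, InfinitePlace.mk τ = v
    · -- only one infinite place: a large natural number
      obtain ⟨N, hN⟩ := exists_nat_gt (C v)
      refine ⟨(N : L), by rw [map_natCast], fun τ => ?_⟩
      have hτ : τ (N : L) = (((N : ℝ)) : ℂ) := by rw [map_natCast, Complex.ofReal_natCast]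
      rw [hτ, Complex.ofReal_re]
      refine ⟨rfl, lt_trans (hC v) hN, fun _ => by rw [hone τ]; exact hN, fun h => ?_⟩
      exact (h (by rw [hone τ]; exact Finset.mem_insert_self v B)).elim
    push Not at hone
    obtain ⟨u, hu⟩ := NumberField.Units.dirichletUnitTheorem.exists_unit L v
    set y : L := ((u : 𝓞 L) : L) with hy
    -- `ξ τ = ‖τ y‖²`: `< 1` off `v`, `> 1` over `v`, always `> 0`
    let ξ : (L →+* ℂ) → ℝ := fun τ => ‖τ y‖ ^ 2
    have hyτ : ∀ τ : L →+* ℂ, (InfinitePlace.mk τ) y = ‖τ y‖ := fun τ => rfl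
    have hξlt : ∀ τ : L →+* ℂ, InfinitePlace.mk τ ≠ v → ξ τ < 1 := by
      intro τ hτ
      have h : (InfinitePlace.mk τ) y < 1 :=
        (Real.log_neg_iff (Units.pos_at_place u (InfinitePlace.mk τ))).mp (hu _ hτ)
      rw [hyτ] at h
      show ‖τ y‖ ^ 2 < 1
      nlinarith [norm_nonneg (τ y)]
    have hξgt : ∀ τ : L →+* ℂ, InfinitePlace.mk τ = v → 1 < ξ τ := by
      intro τ hτ
      obtain ⟨τ₀, hτ₀⟩ := hone
      have h : 1 < v y := one_lt_of_dirichletUnit L v u hu ⟨InfinitePlace.mk τ₀, hτ₀⟩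
      rw [← hτ, hyτ] at h
      show 1 < ‖τ y‖ ^ 2
      nlinarith [norm_nonneg (τ y)]
    have hξpos : ∀ τ : L →+* ℂ, 0 < ξ τ := by
      intro τ
      by_cases hτ : InfinitePlace.mk τ = v
      · exact lt_trans one_pos (hξgt τ hτ)
      · have h0 : 0 < (InfinitePlace.mk τ) y := Units.pos_at_place u _
        rw [hyτ] at h0
        show 0 < ‖τ y‖ ^ 2
        positivity
    -- the real element `x = y ȳ` with `τ x = ξ τ`
    set x : L := y * conjRingHomK L y with hx
    have hxconj : conjRingHomK L x = x := by
      rw [hx, map_mul, conjRingHomK_conjRingHomK, mul_comm]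
    have hxτ : ∀ τ : L →+* ℂ, τ x = ((ξ τ : ℝ) : ℂ) := fun τ => by
      rw [hx, embedding_mul_conjRingHomK]
    -- one exponent `n` that works at every embedding
    have hev : ∀ τ : L →+* ℂ, ∀ᶠ n : ℕ in atTop,
        (InfinitePlace.mk τ = v → C v < (τ t).re + ξ τ ^ n) ∧
        (InfinitePlace.mk τ ≠ v → InfinitePlace.mk τ ∉ B → (τ t).re + ξ τ ^ n < C (InfinitePlace.mk τ)) := by
      intro τ
      by_cases hτ : InfinitePlace.mk τ = v
      · have h1 : Tendsto (fun n : ℕ => ξ τ ^ n) atTop atTop := tendsto_pow_atTop_atTop_of_one_lt (hξgt τ hτ)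
        filter_upwards [h1.eventually_gt_atTop (C v - (τ t).re)] with n hn
        exact ⟨fun _ => by linarith, fun h => absurd hτ h⟩
      · by_cases hB : InfinitePlace.mk τ ∈ B
        · exact Eventually.of_forall fun n => ⟨fun h => absurd h hτ, fun _ h => absurd hB h⟩
        · have hlt : (τ t).re < C (InfinitePlace.mk τ) := (hT τ).2.2.2 hB
          have h0 : Tendsto (fun n : ℕ => ξ τ ^ n) atTop (𝓝 0) :=
            tendsto_pow_atTop_nhds_zero_of_lt_one (hξpos τ).le (hξlt τ hτ)
          filter_upwards [h0.eventually (gt_mem_nhds (sub_pos.mpr hlt))] with n hn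
          exact ⟨fun h => absurd h hτ, fun _ _ => by linarith⟩
    obtain ⟨n, hn⟩ := (eventually_all.mpr hev).exists
    refine ⟨t + x ^ n, by rw [map_add, map_pow, ht, hxconj], fun τ => ?_⟩
    have hτ' : τ (t + x ^ n) = (((τ t).re + ξ τ ^ n : ℝ) : ℂ) := by
      rw [map_add, map_pow, hxτ, (hT τ).1, Complex.ofReal_re]; push_cast; ring
    rw [hτ', Complex.ofReal_re]
    refine ⟨rfl, add_pos (hT τ).2.1 (pow_pos (hξpos τ) n), fun hmem => ?_, fun hnot => ?_⟩
    · rcases Finset.mem_insert.mp hmem with h | h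
      · rw [h]; exact (hn τ).1 h
      · have h1 : C (InfinitePlace.mk τ) < (τ t).re := (hT τ).2.2.1 h
        linarith [pow_pos (hξpos τ) n]
    · rw [Finset.mem_insert, not_or] at hnot
      exact (hn τ).2 hnot.1 hnot.2

/-! ### Signs of `r₀ ρ + r₁` -/

/-- If `|r₁| < |r₀| ρ` the sign of `r₀ ρ + r₁` is that of `r₀`. -/
theorem sign_add_of_dominant {r₀ r₁ ρ : ℝ} (hr₀ : r₀ ≠ 0) (h : |r₁| < |r₀| * ρ) :
    r₀ * ρ + r₁ ≠ 0 ∧ (0 < r₀ * ρ + r₁ ↔ 0 < r₀) := by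
  rcases hr₀.lt_or_gt with h0 | h0
  · rw [abs_of_neg h0] at h
    have : r₀ * ρ + r₁ < 0 := by linarith [le_abs_self r₁]
    exact ⟨this.ne, ⟨fun h' => absurd h' (not_lt.mpr this.le), fun h' => absurd h' (not_lt.mpr h0.le)⟩⟩
  · rw [abs_of_pos h0] at h
    have : 0 < r₀ * ρ + r₁ := by linarith [neg_abs_le r₁]
    exact ⟨this.ne', ⟨fun _ => h0, fun _ => this⟩⟩

/-- If `|r₀| ρ < |r₁|` the sign of `r₀ ρ + r₁` is that of `r₁`. -/
theorem sign_add_of_subordinate {r₀ r₁ ρ : ℝ} (hρ : 0 < ρ) (hr₁ : r₁ ≠ 0) (h : |r₀| * ρ < |r₁|) :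
    r₀ * ρ + r₁ ≠ 0 ∧ (0 < r₀ * ρ + r₁ ↔ 0 < r₁) := by
  have hb : -(|r₀| * ρ) ≤ r₀ * ρ ∧ r₀ * ρ ≤ |r₀| * ρ := by
    constructor <;> nlinarith [le_abs_self r₀, neg_abs_le r₀]
  rcases hr₁.lt_or_gt with h1 | h1
  · rw [abs_of_neg h1] at h
    have : r₀ * ρ + r₁ < 0 := by linarith [hb.2]
    exact ⟨this.ne, ⟨fun h' => absurd h' (not_lt.mpr this.le), fun h' => absurd h' (not_lt.mpr h1.le)⟩⟩
  · rw [abs_of_pos h1] at h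
    have : 0 < r₀ * ρ + r₁ := by linarith [hb.1]
    exact ⟨this.ne', ⟨fun _ => h1, fun _ => this⟩⟩

/-- Same signs: the sign of `r₀ ρ + r₁` is the common one. -/
theorem sign_add_of_same {r₀ r₁ ρ : ℝ} (hρ : 0 < ρ) (hr₀ : r₀ ≠ 0) (hr₁ : r₁ ≠ 0) (h : 0 < r₀ ↔ 0 < r₁) :
    r₀ * ρ + r₁ ≠ 0 ∧ (0 < r₀ * ρ + r₁ ↔ 0 < r₀) := by
  rcases hr₀.lt_or_gt with h0 | h0
  · have h1 : r₁ < 0 := lt_of_le_of_ne (not_lt.mp fun h' => (not_lt.mpr h0.le) (h.mpr h')) hr₁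
    have : r₀ * ρ + r₁ < 0 := by nlinarith
    exact ⟨this.ne, ⟨fun h' => absurd h' (not_lt.mpr this.le), fun h' => absurd h' (not_lt.mpr h0.le)⟩⟩
  · have h1 : 0 < r₁ := h.mp h0
    have : 0 < r₀ * ρ + r₁ := by nlinarith
    exact ⟨this.ne', ⟨fun _ => h0, fun _ => this⟩⟩

/-- `{b, b} = {c, d}` as multisets of Booleans forces `c = b`. -/
theorem bool_pair_eq_left (b c d : Bool) (h : ({b, b} : Multiset Bool) = {c, d}) : c = b := by
  revert b c d; decide

/-! ### The seesaw plane from a sign prescription (model-free) -/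

/-- `{b₀, b₁} = {b₂, b₃}` as multisets of Booleans forces the parity relation `b₀ ↔ (b₁ ↔ b₂) ↔ b₃`. -/
theorem bool_pair_parity (b₀ b₁ b₂ b₃ : Bool) (h : ({b₀, b₁} : Multiset Bool) = {b₂, b₃}) :
    ((b₀ = true ↔ (b₁ = true ↔ b₂ = true)) ↔ b₃ = true) := by
  revert b₀ b₁ b₂ b₃; decide

/-- **Landherr-free seesaw planes** (the content of PerL v5 tex ll. 299–304 "we may and do choose the lines so
that `W₁ ⊕ W₂ ≅ W₃ ⊕ W₄`", for an ARBITRARY sign prescription): let `L` be a CM field and `P i` (`i < 4`) any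
prescription of signs at the real places of `L₀` (= infinite places of `L`) satisfying the pair condition
`{P 0 w, P 1 w} = {P 2 w, P 3 w}` at every place (for PerL's forced signs this is Lemma 3.3(b),
`ThetaModel.reqPos_pairSum`).  Then there are conjugation-fixed non-zero `a₀, …, a₃ ∈ L` with EXACTLY these signs
and an explicit isometry `⟨a₀, a₁⟩ ≅ ⟨a₂, a₃⟩` of hermitian planes over `L/L₀`: `a₀ = e₀ t`, `a₁ = e₁`,
`a₂ = a₀ + a₁`, `a₃ = a₀a₁a₂⁻¹`, `t` totally positive of suitable magnitudes (`exists_totallyPositive_magnitudes`),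
isometry `Lemma33bLandherrProof.isometry_of_rep` with `p = q = z = 1`.  No classification theorem, no local–global
principle: weak approximation of signs + Dirichlet's unit theorem + linear algebra only. -/
theorem exists_seesawDatum_of_signs (L : CMField) (P : Fin 4 → InfinitePlace L → Bool)
    (hpair : ∀ w, ({P 0 w, P 1 w} : Multiset Bool) = {P 2 w, P 3 w}) :
    ∃ D : StubTree.SeesawDatum L,
      ∀ (i : Fin 4) (τ : L →+* ℂ), (0 < (τ (D.a i)).re ↔ P i (InfinitePlace.mk τ) = true) := by
  classical
  obtain ⟨ι₁⟩ : Nonempty (L →+* ℂ) := inferInstance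
  have hpar : ∀ w, ((P 0 w = true ↔ (P 1 w = true ↔ P 2 w = true)) ↔ P 3 w = true) :=
    fun w => bool_pair_parity _ _ _ _ (hpair w)
  -- `e₀, e₁` with the required signs
  obtain ⟨e₀, he₀, h0⟩ := exists_isReal_signs L (P 0)
  obtain ⟨e₁, he₁, h1⟩ := exists_isReal_signs L (P 1)
  have he₀0 : e₀ ≠ 0 := by
    obtain ⟨r, hr, hr0, -⟩ := h0 ι₁; exact Universe.ThetaModel.ne_zero_of_embedding ι₁ hr hr0
  have he₁0 : e₁ ≠ 0 := by
    obtain ⟨r, hr, hr0, -⟩ := h1 ι₁; exact Universe.ThetaModel.ne_zero_of_embedding ι₁ hr hr0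
  -- thresholds `|e₁/e₀|_w` and the set of places where `a₂` must follow the sign of `a₀` against that of `a₁`
  let C : InfinitePlace L → ℝ := fun w => w (e₁ * e₀⁻¹)
  have hC : ∀ w, 0 < C w := fun w => InfinitePlace.pos_iff.mpr (mul_ne_zero he₁0 (inv_ne_zero he₀0))
  let B : Finset (InfinitePlace L) := Finset.univ.filter fun w => P 0 w ≠ P 1 w ∧ P 2 w = P 0 w
  obtain ⟨t, ht, hT⟩ := exists_totallyPositive_magnitudes L B C hC
  -- the sign of `a₂ = e₀ t + e₁` at every embedding
  have hA2 : ∀ τ : L →+* ℂ, ∃ s : ℝ, τ (e₀ * t + e₁) = s ∧ s ≠ 0 ∧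
      (0 < s ↔ P 2 (InfinitePlace.mk τ) = true) := by
    intro τ
    obtain ⟨r₀, hr₀, hr₀0, i0⟩ := h0 τ
    obtain ⟨r₁, hr₁, hr₁0, i1⟩ := h1 τ
    obtain ⟨hρ, hρpos, hbig, hsmall⟩ := hT τ
    set ρ : ℝ := (τ t).re
    have hCτ : C (InfinitePlace.mk τ) = |r₁| / |r₀| := by
      show (InfinitePlace.mk τ) (e₁ * e₀⁻¹) = |r₁| / |r₀|
      rw [InfinitePlace.apply, map_mul, map_inv₀, hr₀, hr₁, norm_mul, norm_inv, Complex.norm_real,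
        Complex.norm_real, Real.norm_eq_abs, Real.norm_eq_abs, div_eq_mul_inv]
    have hr₀abs : 0 < |r₀| := abs_pos.mpr hr₀0
    refine ⟨r₀ * ρ + r₁, by rw [map_add, map_mul, hr₀, hr₁, hρ]; push_cast; ring, ?_⟩
    by_cases h01 : P 0 (InfinitePlace.mk τ) = P 1 (InfinitePlace.mk τ)
    · -- same signs: `a₂` has the common sign, which is the required one
      have h2 : P 2 (InfinitePlace.mk τ) = P 0 (InfinitePlace.mk τ) :=
        bool_pair_eq_left _ _ _ (by have h := hpair (InfinitePlace.mk τ); rw [← h01] at h; exact h)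
      have hs := sign_add_of_same hρpos hr₀0 hr₁0 (by rw [i0, i1, h01])
      exact ⟨hs.1, by rw [hs.2, i0, h2]⟩
    · by_cases h20 : P 2 (InfinitePlace.mk τ) = P 0 (InfinitePlace.mk τ)
      · -- `a₂` must follow `a₀`: `t > |e₁/e₀|` here
        have hmem : InfinitePlace.mk τ ∈ B := by
          simp only [B, Finset.mem_filter, Finset.mem_univ, true_and]; exact ⟨h01, h20⟩
        have hlt : |r₁| < |r₀| * ρ := by
          have h := hbig hmem; rw [hCτ] at h
          rwa [div_lt_iff₀ hr₀abs, mul_comm] at h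
        have hs := sign_add_of_dominant hr₀0 hlt
        exact ⟨hs.1, by rw [hs.2, i0, h20]⟩
      · -- `a₂` must follow `a₁`: `t < |e₁/e₀|` here
        have hnot : InfinitePlace.mk τ ∉ B := by
          simp only [B, Finset.mem_filter, Finset.mem_univ, true_and, not_and]; exact fun _ => h20
        have hlt : |r₀| * ρ < |r₁| := by
          have h := hsmall hnot; rw [hCτ] at h
          rwa [lt_div_iff₀ hr₀abs, mul_comm] at h
        have hs := sign_add_of_subordinate hρpos hr₁0 hlt
        have h21 : P 2 (InfinitePlace.mk τ) = P 1 (InfinitePlace.mk τ) := by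
          revert h01 h20
          cases P 0 (InfinitePlace.mk τ) <;> cases P 1 (InfinitePlace.mk τ) <;>
            cases P 2 (InfinitePlace.mk τ) <;> simp
        exact ⟨hs.1, by rw [hs.2, i1, h21]⟩
  have he2 : e₀ * t + e₁ ≠ 0 := by
    obtain ⟨s, hs, hs0, -⟩ := hA2 ι₁; exact Universe.ThetaModel.ne_zero_of_embedding ι₁ hs hs0
  have ht0 : t ≠ 0 := by
    obtain ⟨hρ, hρpos, -, -⟩ := hT ι₁; exact Universe.ThetaModel.ne_zero_of_embedding ι₁ hρ hρpos.ne'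
  -- the four lines
  let a : Fin 4 → L := ![e₀ * t, e₁, e₀ * t + e₁, e₀ * t * e₁ * (e₀ * t + e₁)⁻¹]
  have ha : ∀ i, conjRingHomK L (a i) = a i := by
    intro i
    fin_cases i
    · show conjRingHomK L (e₀ * t) = e₀ * t
      rw [map_mul, he₀, ht]
    · exact he₁
    · show conjRingHomK L (e₀ * t + e₁) = e₀ * t + e₁
      rw [map_add, map_mul, he₀, ht, he₁]
    · show conjRingHomK L (e₀ * t * e₁ * (e₀ * t + e₁)⁻¹) = e₀ * t * e₁ * (e₀ * t + e₁)⁻¹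
      rw [map_mul, map_mul, map_mul, map_inv₀, map_add, map_mul, he₀, ht, he₁]
  have ha0 : ∀ i, a i ≠ 0 := by
    intro i
    fin_cases i
    · exact mul_ne_zero he₀0 ht0
    · exact he₁0
    · exact he2
    · exact mul_ne_zero (mul_ne_zero (mul_ne_zero he₀0 ht0) he₁0) (inv_ne_zero he2)
  have hz : a 0 * a 1 = a 2 * a 3 * (1 * conjRingHomK L 1) := by
    show e₀ * t * e₁ = (e₀ * t + e₁) * (e₀ * t * e₁ * (e₀ * t + e₁)⁻¹) * (1 * conjRingHomK L 1)
    rw [map_one, mul_one, mul_one]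
    field_simp
  have hrep : a 0 * (1 * conjRingHomK L 1) + a 1 * (1 * conjRingHomK L 1) = a 2 := by
    show e₀ * t * (1 * conjRingHomK L 1) + e₁ * (1 * conjRingHomK L 1) = e₀ * t + e₁
    rw [map_one, mul_one, mul_one, mul_one]
  obtain ⟨g, hg⟩ := Lemma33bLandherrProof.isometry_of_rep L a ha ha0 1 one_ne_zero hz 1 1 hrep
  refine ⟨⟨a, ha, ha0, ⟨g, hg⟩⟩, fun i τ => ?_⟩
  -- the forced signs
  obtain ⟨r₀, hr₀, hr₀0, i0⟩ := h0 τ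
  obtain ⟨r₁, hr₁, hr₁0, i1⟩ := h1 τ
  obtain ⟨s, hs, hs0, i2⟩ := hA2 τ
  obtain ⟨hρ, hρpos, -, -⟩ := hT τ
  fin_cases i
  · show 0 < (τ (e₀ * t)).re ↔ P 0 (InfinitePlace.mk τ) = true
    rw [map_mul, hr₀, hρ, ← Complex.ofReal_mul, Complex.ofReal_re, ← i0]
    exact mul_pos_iff_of_pos_right hρpos
  · show 0 < (τ e₁).re ↔ P 1 (InfinitePlace.mk τ) = true
    rw [hr₁, Complex.ofReal_re]; exact i1
  · show 0 < (τ (e₀ * t + e₁)).re ↔ P 2 (InfinitePlace.mk τ) = true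
    rw [hs, Complex.ofReal_re]; exact i2
  · show 0 < (τ (e₀ * t * e₁ * (e₀ * t + e₁)⁻¹)).re ↔ P 3 (InfinitePlace.mk τ) = true
    have e3 : τ (e₀ * t * e₁ * (e₀ * t + e₁)⁻¹) = ((r₀ * (τ t).re * r₁ / s : ℝ) : ℂ) := by
      rw [map_mul, map_mul, map_inv₀, hs, map_mul, hr₀, hr₁, hρ, Complex.ofReal_re]; push_cast; ring
    have hx0 : r₀ * (τ t).re ≠ 0 := mul_ne_zero hr₀0 hρpos.ne'
    have hx : 0 < r₀ * (τ t).re ↔ 0 < r₀ := mul_pos_iff_of_pos_right hρpos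
    rw [e3, Complex.ofReal_re, pos_mul_div_iff hx0 hr₁0 hs0, hx, i0, i1, i2]
    exact hpar (InfinitePlace.mk τ)

namespace Universe

namespace ThetaModel

variable {U : Universe} (T : U.ThetaModel)


-- port_pkg: scope closed for this part
end ThetaModel
end Universe
end HodgeCM
end
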